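import Mathlib
import Summits.NavierStokesRegularity.NavierStokesRegularity.Theorems.TaoLadderRungTwoFlatTruncatedHopAnchored
import Summits.NavierStokesRegularity.NavierStokesRegularity.Theorems.TaoLadderRungTwoFlatTruncatedHopLanding
import HarnessLib

/-!
# The CORE PHASE LANDING with amplitude-form inputs: `truncated_hop_estimate_anchored` ∘ `anchored_landing`, with the
  interface forcing expressed by the interface histories and the anchor coefficient bounded from the anchor-site data
  (helper for the K_A♭ parent item stmt-NavierStokesRegularity-22987 `FlatGapCertificatesV2`, children 1A/2A of route
  TaoLadderRungTwoFlat; cell harvest/h2-tao-ladder, p1 g22; L5a ⇒ `HopTube.TubeStepCore` for the flat tube, LADDER §49.5/§51)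

`MirrorPulse.truncated_hop_estimate_anchored` (L5a) takes the interface forcing bounds `F` (head gauge) and `F_ω`
(contraction gauge) on `[0, τ]` as constants and RETURNS an existential phase coefficient `c₁`; `MirrorPulse.anchored_landing`
then needs `|c₁|, |ĉ₂| ≤ C_aB ≤ 1/2` for `ĉ₂ = anchorCoeff(η, c₁)`. This file closes both book-keeping gaps:

* the forcing constants from AMPLITUDES: with the pulse tail `η̂` at the two interface values on `[0, τ]`, the near
  edge history `|u_{1,e}| ≤ q̄` and the core interface history `|u_{0,e+1}| ≤ r̄` (the quantities the per-hop bootstrap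
  `hop_apriori_flat_bounds` delivers), `F := q̄(2η̂ + q̄ + ε(η̂ + r̄)) + r̄(η̂ + ε(2η̂ + r̄))` (head gauge `= 1` at the
  interface sites `e, e+1 ≤ 0`) and `F_ω := ω_{0,e+1}·(first) + ω_{1,e}·(second)`;
* the anchor coefficient from the ANCHOR-SITE DATA: `|ĉ₂| ≤ (R_τ + C B·Q_a)/φ_a` from `|η_{i₀,1}(τ)| ≤ R_τ`,
  `|Q(Φ)_{i₀,1}(τ)| ≤ Q_a`, `|Φ_{i₀,1}(τ)| ≥ φ_a > 0`;

* `MirrorPulse.core_phase_landing_flat` — **∃ κ h with `|κ − 1| ≤ C_aB`, `|h| ≤ 2C_aB`, `κ ≥ 0`, such that on every core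
  read-out site `k ≥ e`: `ω_{i,k}|X_{i,k+1}(τ) − κΦ_{i,k+1}(τ + h)| ≤ E_land`**, `E_land = ρB + (1+q)·Rem(B′, F, F_ω) +
  12C_aB²‖T♭‖₁²g²M_w³` explicit — the input `hD` (core part) of `HopTube.core_landing_at_section_time`.

HONEST FRAMING: a conditional estimate about MODEL-lattice solutions (Tao 2016 §4 vocabulary on `S♭`, flat clocks); the
anchored contraction (S2) and all bounds are HYPOTHESES; nothing certified; nothing about the Navier–Stokes equations.
-/

noncomputable section

-- the sub-problem namespace repeats the summit name by design (D-0017)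
set_option linter.dupNamespace false

namespace Summit.NavierStokesRegularity.NavierStokesRegularity.Theorems

open Set Filter Literature.Analysis.FluidPDE Literature.Analysis.FluidPDE.TaoCascade QuadPolar
open scoped Topology

namespace MirrorPulse

/-- Behind and at the window bottom the head gauge is `1` (`m ≤ 0`). [folklore; route TaoLadderRungTwoFlat, gauge bookkeeping] -/
theorem headGauge_of_nonpos (g : ℝ) (i : Fin 2) {m : ℤ} (hm : m ≤ 0) : headGauge g i m = 1 := by
  unfold headGauge
  rw [Int.toNat_of_nonpos hm, pow_zero]

/-- **THE CORE PHASE LANDING (flat, scale 1) with amplitude-form inputs.** See the module docstring.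
[cite: Tao2016AveragedNS, §4 (4.8), §6.3–6.4 (statement shape of the checkpoint step); route TaoLadderRungTwoFlat, L5a + landing (LADDER §49.5 (b), §51)] -/
theorem core_phase_landing_flat {ε τ : ℝ} {Φ X : Fin 2 → ℤ → ℝ → ℝ} {g b ρ C M Mw B B' q ηhat qbar rbar Rτ Qa φa CaB : ℝ}
    {e : ℤ} {i₀ : Fin 2} (hΦ : IsGlobalSol ε Φ) (hX : IsGlobalSol ε X) (hε : 0 ≤ ε) (hτ : 0 ≤ τ) (he : e + 1 ≤ 0)
    (hΦb : ∀ i n t, |Φ i n t| ≤ M) (hXb : ∀ i n t, |X i n t| ≤ M) (hg : 1 ≤ g) (hb : 1 ≤ b)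
    (hS2 : AnchoredHopContraction ε τ Φ (geomGauge g b) i₀ ρ C) (hq : 0 ≤ q)
    (hprof : ∀ (i : Fin 2) (k : ℤ), ¬(i = i₀ ∧ k = 0) →
      geomGauge g b i k * |Φ i (k + 1) τ| ≤ q * (geomGauge g b i₀ 0 * |Φ i₀ 1 τ|))
    (hMw : 0 ≤ Mw) (hΦg : ∀ j k, ∀ t ∈ Icc (τ - 1) (τ + 1), headGauge g j k * |Φ j k t| ≤ Mw)
    (hB : ∀ i k, geomGauge g b i k * |truncFam e (X - Φ) i k 0| ≤ B)
    (hB' : ∀ i k, headGauge g i k * |truncFam e (X - Φ) i k 0| ≤ B')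
    (hηhat : 0 ≤ ηhat) (hVe : ∀ t ∈ Icc 0 τ, |Φ 1 e t| ≤ ηhat) (hAe : ∀ t ∈ Icc 0 τ, |Φ 0 (e + 1) t| ≤ ηhat)
    (hqbar : 0 ≤ qbar) (hqh : ∀ t ∈ Icc 0 τ, |(X - Φ) 1 e t| ≤ qbar)
    (hrbar : 0 ≤ rbar) (hrh : ∀ t ∈ Icc 0 τ, |(X - Φ) 0 (e + 1) t| ≤ rbar)
    (hRτ : |(X - Φ) i₀ 1 τ| ≤ Rτ) (hQa : |quadTermOn shiftSetFlat 0 (mirrorTable ε ε) Φ i₀ 1 τ| ≤ Qa)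
    (hφa : 0 < φa) (hφale : φa ≤ |Φ i₀ 1 τ|)
    (hCaB1 : C * B ≤ CaB) (hCaB2 : (Rτ + C * B * Qa) / φa ≤ CaB) (hCaB : CaB ≤ 1 / 2) :
    ∃ κ h : ℝ, |κ - 1| ≤ CaB ∧ |h| ≤ 2 * CaB ∧ 0 ≤ κ ∧
      ∀ (i : Fin 2) (k : ℤ), e ≤ k →
        geomGauge g b i k * |X i (k + 1) τ - κ * Φ i (k + 1) (τ + h)|
          ≤ (ρ * B + (1 + q) * ((tableAbsSum shiftSetFlat (mirrorTable ε ε) * g *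
              ((B' + (qbar * (2 * ηhat + qbar + ε * (ηhat + rbar)) + rbar * (ηhat + ε * (2 * ηhat + rbar))) * τ)
                * Real.exp (2 * tableAbsSum shiftSetFlat (mirrorTable ε ε) * M * g * τ)) ^ 2
              + (geomGauge g b 0 (e + 1) * (qbar * (2 * ηhat + qbar + ε * (ηhat + rbar)))
                + geomGauge g b 1 e * (rbar * (ηhat + ε * (2 * ηhat + rbar))))) * τ *
              Real.exp (2 * tableAbsSum shiftSetFlat (mirrorTable ε ε) * M * max g b * τ)))
            + 12 * CaB ^ 2 * ((tableAbsSum shiftSetFlat (mirrorTable ε ε)) ^ 2 * g ^ 2 * Mw ^ 3) := by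
  obtain ⟨hωpos, _, _, hC0, hΦa, _⟩ := id hS2
  have hg0 : 0 ≤ g := by linarith
  -- the interface forcing from the amplitudes, in both gauges
  have hc0 : ∀ n : ℤ, clock 0 n = 1 := fun n => by unfold clock; simp
  have hF0 : 0 ≤ qbar * (2 * ηhat + qbar + ε * (ηhat + rbar)) + rbar * (ηhat + ε * (2 * ηhat + rbar)) := by
    positivity
  have hFω0 : 0 ≤ geomGauge g b 0 (e + 1) * (qbar * (2 * ηhat + qbar + ε * (ηhat + rbar)))
      + geomGauge g b 1 e * (rbar * (ηhat + ε * (2 * ηhat + rbar))) := by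
    have h1 := (hωpos 0 (e + 1)).le
    have h2 := (hωpos 1 e).le
    positivity
  -- pointwise bounds of the two forcing components
  have hf0 : ∀ t ∈ Icc 0 τ, |interfaceForcing ε 0 e Φ (X - Φ) 0 (e + 1) t|
      ≤ qbar * (2 * ηhat + qbar + ε * (ηhat + rbar)) := by
    intro t ht
    have h := abs_interfaceForcing_carrier_le hε (by norm_num : (-1 : ℝ) ≤ 0) e Φ (X - Φ) t
    rw [hc0, one_mul] at h
    refine h.trans ?_
    have hin : 2 * |Φ 1 e t| + |(X - Φ) 1 e t| + ε * (|Φ 0 (e + 1) t| + |(X - Φ) 0 (e + 1) t|)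
        ≤ 2 * ηhat + qbar + ε * (ηhat + rbar) := by
      have := mul_le_mul_of_nonneg_left (add_le_add (hAe t ht) (hrh t ht)) hε
      linarith [hVe t ht, hqh t ht]
    exact mul_le_mul (hqh t ht) hin (by positivity) hqbar
  have hf1 : ∀ t ∈ Icc 0 τ, |interfaceForcing ε 0 e Φ (X - Φ) 1 e t| ≤ rbar * (ηhat + ε * (2 * ηhat + rbar)) := by
    intro t ht
    have h := abs_interfaceForcing_bond_le hε (by norm_num : (-1 : ℝ) ≤ 0) e Φ (X - Φ) t
    rw [hc0, one_mul] at h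
    refine h.trans ?_
    have hin : |Φ 1 e t| + ε * (2 * |Φ 0 (e + 1) t| + |(X - Φ) 0 (e + 1) t|) ≤ ηhat + ε * (2 * ηhat + rbar) := by
      have h3 : 2 * |Φ 0 (e + 1) t| + |(X - Φ) 0 (e + 1) t| ≤ 2 * ηhat + rbar := by linarith [hAe t ht, hrh t ht]
      have := mul_le_mul_of_nonneg_left h3 hε
      linarith [hVe t ht]
    exact mul_le_mul (hrh t ht) hin (by positivity) hrbar
  have hfb : ∀ j k, ∀ t ∈ Icc 0 τ, headGauge g j k * |interfaceForcing ε 0 e Φ (X - Φ) j k t|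
      ≤ qbar * (2 * ηhat + qbar + ε * (ηhat + rbar)) + rbar * (ηhat + ε * (2 * ηhat + rbar)) := by
    intro j k t ht
    by_cases h0 : j = 0 ∧ k = e + 1
    · obtain ⟨rfl, rfl⟩ := h0
      rw [headGauge_of_nonpos g 0 he, one_mul]
      exact (hf0 t ht).trans (le_add_of_nonneg_right (by positivity))
    by_cases h1 : j = 1 ∧ k = e
    · obtain ⟨rfl, rfl⟩ := h1
      rw [headGauge_of_nonpos g 1 (by omega), one_mul]
      exact (hf1 t ht).trans (le_add_of_nonneg_left (by positivity))
    · rw [interfaceForcing_eq_zero ε 0 Φ (X - Φ) h0 h1 t, abs_zero, mul_zero]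
      exact hF0
  have hfω : ∀ j k, ∀ t ∈ Icc 0 τ, geomGauge g b j k * |interfaceForcing ε 0 e Φ (X - Φ) j k t|
      ≤ geomGauge g b 0 (e + 1) * (qbar * (2 * ηhat + qbar + ε * (ηhat + rbar)))
        + geomGauge g b 1 e * (rbar * (ηhat + ε * (2 * ηhat + rbar))) := by
    intro j k t ht
    by_cases h0 : j = 0 ∧ k = e + 1
    · obtain ⟨rfl, rfl⟩ := h0
      exact (mul_le_mul_of_nonneg_left (hf0 t ht) (hωpos 0 (e + 1)).le).trans
        (le_add_of_nonneg_right (mul_nonneg (hωpos 1 e).le (by positivity)))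
    by_cases h1 : j = 1 ∧ k = e
    · obtain ⟨rfl, rfl⟩ := h1
      exact (mul_le_mul_of_nonneg_left (hf1 t ht) (hωpos 1 k).le).trans
        (le_add_of_nonneg_left (mul_nonneg (hωpos 0 (k + 1)).le (by positivity)))
    · rw [interfaceForcing_eq_zero ε 0 Φ (X - Φ) h0 h1 t, abs_zero, mul_zero]
      exact hFω0
  -- L5a
  obtain ⟨c₁, hc₁, hmain⟩ := truncated_hop_estimate_anchored hΦ hX hτ hΦb hXb hg hb hS2 hq hprof hB hB' hF0 hfb
    hFω0 hfω
  -- the anchor coefficient from the anchor-site data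
  have hCB0 : 0 ≤ C * B := by
    have hB0 : 0 ≤ B := le_trans (mul_nonneg (hωpos 0 0).le (abs_nonneg _)) (hB 0 0)
    exact mul_nonneg hC0 hB0
  have hc₂ : |anchorCoeff ε τ Φ i₀ (truncFam e (X - Φ)) c₁| ≤ CaB := by
    unfold anchorCoeff
    rw [abs_div]
    have hΦa0 : 0 < |Φ i₀ 1 τ| := abs_pos.mpr hΦa
    have hnum : |truncFam e (X - Φ) i₀ 1 τ - c₁ * quadTermOn shiftSetFlat 0 (mirrorTable ε ε) Φ i₀ 1 τ|
        ≤ Rτ + C * B * Qa := by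
      have e1 : truncFam e (X - Φ) i₀ 1 τ = (X - Φ) i₀ 1 τ := by
        rw [truncFam_of_le (by omega)]
      rw [e1]
      refine (abs_sub _ _).trans (add_le_add hRτ ?_)
      rw [abs_mul]
      exact mul_le_mul hc₁ hQa (abs_nonneg _) hCB0
    have hRQ0 : 0 ≤ Rτ + C * B * Qa := (abs_nonneg _).trans hnum
    calc |truncFam e (X - Φ) i₀ 1 τ - c₁ * quadTermOn shiftSetFlat 0 (mirrorTable ε ε) Φ i₀ 1 τ| / |Φ i₀ 1 τ|
        ≤ (Rτ + C * B * Qa) / φa := div_le_div₀ hRQ0 hnum hφa hφale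
      _ ≤ CaB := hCaB2
  -- the landing at each core read-out site
  refine ⟨1 + anchorCoeff ε τ Φ i₀ (truncFam e (X - Φ)) c₁,
    c₁ / (1 + anchorCoeff ε τ Φ i₀ (truncFam e (X - Φ)) c₁), ?_, ?_, ?_, fun i k hk => ?_⟩
  · simpa using hc₂
  · exact (anchored_landing hΦ hg hb hMw hΦg (hc₁.trans hCaB1) hc₂ hCaB hmain i₀ 0
      (truncFam_sub_readout (show e ≤ 0 by omega) X Φ i₀ τ)).2.1
  · have := (abs_le.mp (hc₂.trans hCaB)).1
    linarith
  · have hηX : truncFam e (X - Φ) i (k + 1) τ = X i (k + 1) τ - Φ i (k + 1) τ := truncFam_sub_readout hk X Φ i τ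
    exact (anchored_landing hΦ hg hb hMw hΦg (hc₁.trans hCaB1) hc₂ hCaB hmain i k hηX).2.2

end MirrorPulse

end Summit.NavierStokesRegularity.NavierStokesRegularity.Theorems

end
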